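import Literature.Claims.NS.Han2013

/-!
# C26 `Han2013` — kernel refutation of the Gronwall step of Lemma 2.1

D-0090 NS-CLAIMS sweep, row C26: P. Han, *Global regular solutions for the 3D Navier–Stokes
equations* (arXiv 1307.1012 **v1**, 2013-06; withdrawn by the author in v2 «due to a crucial
error in Section 2»; the row types v1 as printed).  Skeleton `Literature.Claims.NS.Han2013`
(p470314 typist-7, rev 2 typist-6 g2).  Kernel author: ns-claims-refuter-6 g0; filed unchanged by a
salvage seat (cell convention (b)).

LOCATOR.  Proof of Lemma 2.1, print p.7, the sentence after (2.21) (TeX l.575–578): from the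
integrated `D^m`-energy inequality (2.21) = (LEs-mF2)
`‖D^m{(u·∇)u}(t)‖² ≤ ∫₀ᵗ ‖(u·∇)u(τ)‖²_{H^∞} dτ + ‖(u₀·∇)u₀‖²_{H^∞} + C‖u₀‖⁴_{H^∞} t + F(t)`
the text says «set `D^m = ∂_j^m`, sum over `j`, take the maximum over `m ≥ 0`.  Then by using
Gronwall inequality, we derive (EnEs-LNS3)» = (2.10) p.5.  Gronwall is applied to
`X(t) := ‖(u·∇)u(t)‖²_{H^∞} ∈ [0, ∞]` with NO a-priori finiteness or local integrability of `X`
— that finiteness («`(u·∇)u ∈ C([0,T]; H^∞)`») is part of what Lemma 2.1 asserts.  The typed step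
`Step_L21G` is exactly this inference over `[0,∞]`-valued `X` (monotone finite `A`, the
hypothesis `X t ≤ A t + ∫₀ᵗ X`, the conclusion `X t ≤ A t · eᵗ`).

WITNESSES.  (1) `Xw`: `X(0) = 0`, `X(t) = ⊤` for `t > 0`, `A ≡ 1`, `T = 1` — the hypothesis holds
(trivially at `t = 0`; for `t > 0` because `∫₀ᵗ X = ⊤`), the conclusion fails at `t = 1`.  This
is the profile of the actual quantity in the paper's class: the paper's `H^∞` (max-norm (1.4),
TeX l.163–168) consists of `L²` fields with Fourier support in the unit cube; products double
the band, so for `u₀ = 0` and a forcing with `f̂` supported near the faces of the cube the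
semigroup solution has `‖(u·∇)u(t)‖_{H^∞} = ∞` for `t > 0` while the right side of (2.10) is
finite — (2.10) fails in the class (on paper; REF PRE-READ ref-2 g2 2026-08-27T00:05:33Z gives an
explicit two-packet pair).  (2) `Xi`: `X(t) = 1/t` for `t > 0`, `X(0) = 0` — pointwise FINITE,
still `∫₀ᵗ X = ⊤`, and the conclusion fails at `t = 1/4` (`4 ≤ e^{1/4}` is false): adding
pointwise finiteness does not rescue the step (`not_Step_L21G_ptFinite`, statement inlined); only local
integrability of `X` on `[0,T]` does (classical Gronwall) — and that is the lemma's own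
conclusion.

CLASS (refuter's reading, REF PRE-READ concurring): false lemma (countermodel).

WHAT THIS IS NOT: not a claim about NS regularity or blow-up; not a claim about any author beyond
the typed locator.
-/

set_option linter.dupNamespace false

open scoped ENNReal
open MeasureTheory Set

noncomputable section

namespace Summit.NavierStokesRegularity.NavierStokesRegularity.Theorems.Han2013

/-- First witness: `0` at `t ≤ 0`, `⊤` for `t > 0` (the band-doubling profile: finite at the
initial time by the data hypothesis `(u₀·∇)u₀ ∈ H^∞`, `+∞` immediately after). -/
def Xw : ℝ → ℝ≥0∞ := fun t => if t ≤ 0 then 0 else ⊤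

/-- `Xw` vanishes at non-positive times. -/
lemma Xw_of_nonpos {t : ℝ} (ht : t ≤ 0) : Xw t = 0 := if_pos ht

/-- `Xw = ⊤` at positive times. -/
lemma Xw_of_pos {t : ℝ} (ht : 0 < t) : Xw t = ⊤ := if_neg (not_le.mpr ht)

/-- `∫₀ᵗ Xw = ⊤` for `t > 0`. -/
lemma lintegral_Xw {t : ℝ} (ht : 0 < t) : ∫⁻ τ in Ioo 0 t, Xw τ = ⊤ := by
  have hcongr : ∫⁻ τ in Ioo 0 t, Xw τ = ∫⁻ _ in Ioo 0 t, (⊤ : ℝ≥0∞) :=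
    setLIntegral_congr_fun measurableSet_Ioo (fun x hx => Xw_of_pos hx.1)
  rw [hcongr, setLIntegral_const, Real.volume_Ioo]
  simp [ENNReal.top_mul, ENNReal.ofReal_eq_zero, not_le.mpr ht]

/-- `Xw` satisfies the Gronwall HYPOTHESIS of `Step_L21G` with `A ≡ 1` on `[0,1]`. -/
lemma Xw_hypothesis : ∀ t ∈ Icc (0:ℝ) 1, Xw t ≤ 1 + ∫⁻ τ in Ioo 0 t, Xw τ := by
  intro t ht
  rcases eq_or_lt_of_le ht.1 with h0 | hpos
  · rw [← h0, Xw_of_nonpos le_rfl]; exact bot_le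
  · rw [lintegral_Xw hpos]; simp

/-- **C26 kill (locator).**  The Gronwall step of the proof of Lemma 2.1 (print p.7, sentence
after (2.21); TeX l.575–578), typed as `Literature.Claims.NS.Han2013.Step_L21G` over
`[0,∞]`-valued `X` exactly as used, is false: witness `X = Xw` (`0` at `t = 0`, `⊤` after),
`A ≡ 1`, `T = 1`; the hypothesis holds, the conclusion `⊤ ≤ 1 · e¹` fails at `t = 1`.
[cite: Han2013, proof of Lemma 2.1, sentence after (2.21) p.7 «Then by using Gronwall
inequality, we derive (EnEs-LNS3)»] -/
theorem not_Step_L21G : ¬ Literature.Claims.NS.Han2013.Step_L21G := by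
  intro h
  have := h 1 Xw (fun _ => 1) one_pos monotone_const (fun t _ => ENNReal.one_lt_top)
    Xw_hypothesis 1 ⟨zero_le_one, le_rfl⟩
  rw [Xw_of_pos one_pos, one_mul, top_le_iff] at this
  exact ENNReal.ofReal_ne_top this

/-! ## The pointwise-finite variant is still false (second witness `1/t`) -/

/-- Second witness: `1/t` for `t > 0`, `0` at `t ≤ 0` (pointwise finite, not integrable at `0⁺`). -/
def Xi : ℝ → ℝ≥0∞ := fun t => if t ≤ 0 then 0 else ENNReal.ofReal t⁻¹

/-- `Xi` vanishes at non-positive times. -/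
lemma Xi_of_nonpos {t : ℝ} (ht : t ≤ 0) : Xi t = 0 := if_pos ht

/-- `Xi t = 1/t` at positive times. -/
lemma Xi_of_pos {t : ℝ} (ht : 0 < t) : Xi t = ENNReal.ofReal t⁻¹ := if_neg (not_le.mpr ht)

/-- `∫₀ᵗ dτ/τ = ⊤` for `t > 0` (via Mathlib's `intervalIntegrable_inv_iff`). -/
lemma lintegral_Xi {t : ℝ} (ht : 0 < t) : ∫⁻ τ in Ioo 0 t, Xi τ = ⊤ := by
  have h1 : ∫⁻ τ in Ioo 0 t, Xi τ = ∫⁻ τ in Ioo 0 t, ‖τ⁻¹‖ₑ := by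
    refine setLIntegral_congr_fun measurableSet_Ioo (fun x hx => ?_)
    rw [Xi_of_pos hx.1, Real.enorm_eq_ofReal_abs, abs_of_pos (inv_pos.mpr hx.1)]
  rw [h1]
  by_contra hne
  have hfin : HasFiniteIntegral (fun τ : ℝ => τ⁻¹) (volume.restrict (Ioo 0 t)) :=
    (hasFiniteIntegral_iff_enorm).mpr (lt_top_iff_ne_top.mpr hne)
  have hint : IntegrableOn (fun τ : ℝ => τ⁻¹) (Ioo 0 t) :=
    ⟨measurable_inv.aestronglyMeasurable, hfin⟩
  have hii : IntervalIntegrable (fun τ : ℝ => τ⁻¹) volume 0 t :=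
    (intervalIntegrable_iff_integrableOn_Ioo_of_le ht.le).mpr hint
  rw [intervalIntegrable_inv_iff] at hii
  rcases hii with h | h
  · exact ht.ne h
  · exact h Set.left_mem_uIcc

/-- `e^{1/4} < 4`. -/
lemma exp_quarter_lt_four : Real.exp (1/4) < 4 := by
  have h1 : Real.exp (1/4) < Real.exp 1 := Real.exp_lt_exp.mpr (by norm_num)
  have h2 : Real.exp 1 < 4 := lt_trans Real.exp_one_lt_d9 (by norm_num)
  exact lt_trans h1 h2

/-- **Companion (the referee's first charity).**  The same Gronwall step WITH pointwise finiteness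
of `X` on `[0,T]` added (still no local integrability) is false: witness
`X = Xi` (`1/t`), `A ≡ 1`, `T = 1`; the hypothesis holds because `∫₀ᵗ dτ/τ = ⊤`, the
conclusion fails at `t = 1/4` (`4 ≤ e^{1/4}` is false).  Only LOCAL INTEGRABILITY of
`X = ‖(u·∇)u‖²_{H^∞}` on `[0,T]` rescues the printed inference — and that is Lemma 2.1's own
assertion «`(u·∇)u ∈ C([0,T];H^∞)`». [cite: Han2013, proof of Lemma 2.1, sentence after (2.21) p.7] -/
theorem not_Step_L21G_ptFinite : ¬ (∀ (T : ℝ) (X A : ℝ → ℝ≥0∞), 0 < T → Monotone A →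
    (∀ t ∈ Icc 0 T, A t < ⊤) → (∀ t ∈ Icc 0 T, X t < ⊤) →
    (∀ t ∈ Icc 0 T, X t ≤ A t + ∫⁻ τ in Ioo 0 t, X τ) →
    ∀ t ∈ Icc 0 T, X t ≤ A t * ENNReal.ofReal (Real.exp t)) := by
  intro h
  have hyp : ∀ t ∈ Icc (0:ℝ) 1, Xi t ≤ 1 + ∫⁻ τ in Ioo 0 t, Xi τ := by
    intro t ht
    rcases eq_or_lt_of_le ht.1 with h0 | hpos
    · rw [← h0, Xi_of_nonpos le_rfl]; exact bot_le
    · rw [lintegral_Xi hpos]; simp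
  have hfinX : ∀ t ∈ Icc (0:ℝ) 1, Xi t < ⊤ := by
    intro t ht
    rcases eq_or_lt_of_le ht.1 with h0 | hpos
    · rw [← h0, Xi_of_nonpos le_rfl]; exact ENNReal.zero_lt_top
    · rw [Xi_of_pos hpos]; exact ENNReal.ofReal_lt_top
  have := h 1 Xi (fun _ => 1) one_pos monotone_const (fun t _ => ENNReal.one_lt_top) hfinX hyp
    (1/4) ⟨by norm_num, by norm_num⟩
  rw [Xi_of_pos (by norm_num), one_mul, ENNReal.ofReal_le_ofReal_iff (Real.exp_pos _).le] at this
  have h4 : ((1:ℝ)/4)⁻¹ = 4 := by norm_num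
  rw [h4] at this
  exact absurd this (not_le.mpr exp_quarter_lt_four)

end Summit.NavierStokesRegularity.NavierStokesRegularity.Theorems.Han2013

end
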